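import Summits.HodgeConjecture.HodgeConjecture.Theorems.F0P2aCohFormsFixedFinite
import Summits.HodgeConjecture.HodgeConjecture.Theorems.F0P2aFrameTransport
import Literature.NumberTheory.Automorphic.UnitaryGroupCohomologicalForms
import Literature.NumberTheory.Automorphic.UnitaryGroupFrameHermitian
import Literature.NumberTheory.Automorphic.SmoothRepresentation
import Literature.AlgebraicGeometry.ShimuraVarieties.UnitaryBallRealPoints
import Mathlib.RepresentationTheory.Irreducible
import HarnessLib

/-!
# FLOOR-0 P2a (B4-ARCHIMEDEAN DESK, line 2) — stub S3 `AdmissibleOfCohValuedType`: an irreducible smooth `σ` with a non-zero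
# equivariant map into the cohomological cotangent forms is ADMISSIBLE

Cell hodgecm-mathlib (D-0151), FLOOR 0, crux item H413 = stmt-HodgeConjecture-24833 (route `HCCMUnconditional`); line
`Cruxes/H413/Lines/F0_P2aCohIsotypicLine.lean` (sha16 fe64be0a9875628f) §1 S3 / §2 `stub_admissible_of_cohValued : AdmissibleOfCohValuedType`;
prover F0P2a-p07 (g0).  `--supports stmt-HodgeConjecture-24833`.  THEOREMS ONLY — no definition, no instance, no notation, no named fact, no
`sorry`; imports = ★ tree; the head's type is the BODY of the registered `def AdmissibleOfCohValuedType` token for token (line abbrevs `𝒰`, `Gf`, `Rf`,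
`coh` unfolded), so that the next edition of the line folds `theorem stub_admissible_of_cohValued : AdmissibleOfCohValuedType := stubS3_holds`.

## The argument ([BernsteinZelevinsky1976, §2.1]; [BorelWallach2000, VII 3.2, XIII 1.2])
`σ` irreducible and `ψ ≠ 0` equivariant ⇒ `ψ` is injective (Mathlib `Representation.IsIrreducible.injective_or_eq_zero`).  For an open compact
`K ≤ U(H)(𝔸_{L⁺,f})`, `ψ` maps `σ^K` into the right-`K`-invariant cohomological cotangent forms of the frame `(T, hT)`; right translation by a
fixed archimedean element `a` (the FRAME TRANSPORT, commuting with `U(H)(𝔸_f)`) carries these injectively into the right-`K`-invariant forms of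
the factor OF RECORD `archFactorOf ⟨L⟩ V` (`V` the hermitian 3-space `(H, T)`, ★ `cmConjRingHom_apply_eq_of_formCongr_eq_J`), which are
finite-dimensional by ★ `F0P2aCohFormsFixedFinite.finite_cohForms_inf_invariants` (the Matsushima–Hodge class map into the admissible tower
`colim_K H¹(X_K(ℂ); ℂ)`; `4 ≤ [L:ℚ]` ⇐ `2 ≤ [L⁺:ℚ]`).  Hence `σ^K` is finite-dimensional: `σ` is admissible.

* §1 `injective_of_equivariant_ne_zero` — Schur: a non-zero equivariant linear map out of an irreducible representation is injective.
* §2 `finite_fixedPoints_of_frameTransport` — the core, frame-spelling-agnostic: ANY submodule `A` of forms carried by `Φ ↦ Φ(· a)` into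
  `cohForms (archFactorOf F V)` with `a` commuting with the finite-adelic factor, and any injective equivariant `ψ : σ → A`, give `dim σ^K < ∞`.
* §3 `stubS3_holds_of_transport` (any transport of the ★ shape) and the registered letter `stubS3_holds`, by the frame transport ★
  `F0P2aFrameTransport.mem_cohForms_frameTransport` (F0P2a-p06, p795940).

HC_CM is proved only modulo the printed citations until rung 0 closes; this file proves nothing about them.

## References
* [BernsteinZelevinsky1976] I. N. Bernstein, A. V. Zelevinsky, Russian Math. Surveys 31 (1976), §2.1 (smooth / admissible representations).
* [BorelWallach2000] A. Borel, N. Wallach, 2nd ed. (2000), VII 3.2 (Matsushima), XIII 1.2 (admissibility of the adelic tower).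
* [BorelJacquet1979] A. Borel, H. Jacquet, Corvallis PSPM 33.1, §4.1–4.2 (`G(𝔸) = G_∞ · G(𝔸_f)`, right translation).
* Tree: ★ `Theorems/F0P2aCohFormsFixedFinite` (p07), ★ `Theorems/F0P2aFrameTransport` (p06; `cohForms (archFactorOf …)` IS the generic `cohForms`
  at the Sylvester frame by `rfl`, cf. ★ `H413SpectrumJunctionPin.cohForms_eq_generic`),
  ★ `Literature/…/SmoothRepresentation` (`IsAdmissible`, `fixedPoints`), ★ `UnitaryGroupFrameHermitian`, Mathlib `RepresentationTheory.Irreducible`.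
-/

set_option autoImplicit false
set_option linter.dupNamespace false

noncomputable section

open NumberField
open scoped Matrix ComplexOrder
open Literature.NumberTheory.Automorphic Literature.NumberTheory.Automorphic.UnitaryGroup
open Literature.NumberTheory.Automorphic.UnitaryGroup.CotangentForms (cmArchSection cmCompactFactor)
open Summit.HodgeConjecture.HodgeConjecture.Cruxes.H413.CohFormsCarriers

namespace Summit.HodgeConjecture.HodgeConjecture.Cruxes.H413.F0P2aStubAdmissibleOfCohValued

/-! ## §1 Schur: a non-zero equivariant map out of an irreducible representation is injective -/

/-- **Schur.**  For `σ` irreducible (Mathlib `Representation.IsIrreducible`) and `ρ` any representation of the same group, a `σ → ρ`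
equivariant linear map is injective or zero (Mathlib `Representation.IsIrreducible.injective_or_eq_zero` on the bundled
`IntertwiningMap`). [cite: BernsteinZelevinsky1976, §2.1] -/
theorem injective_of_equivariant_ne_zero {G : Type*} [Group G] {W X : Type*} [AddCommGroup W] [Module ℂ W] [AddCommGroup X] [Module ℂ X]
    (σ : Representation ℂ G W) (ρ : Representation ℂ G X) (hirr : σ.IsIrreducible) (ψ : W →ₗ[ℂ] X)
    (hE : ∀ (g : G) (w : W), ψ (σ g w) = ρ g (ψ w)) (hne : ψ ≠ 0) : Function.Injective ψ := by
  haveI := hirr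
  rcases Representation.IsIrreducible.injective_or_eq_zero (LinearMap.intertwiningMap_of_isIntertwiningMap σ ρ ψ hE) with h | h
  · exact h
  · exact absurd (congrArg Representation.IntertwiningMap.toLinearMap h) hne

/-! ## §2 The core: finite-dimensional `K`-fixed vectors from a frame transport into the factor of record -/

/-- **Core of S3 (frame-spelling-agnostic).**  `V` a hermitian 3-space over a CM field `F` with `4 ≤ [F:ℚ]`; `A` any space of `ℂ²`-valued
functions on `U(V)(𝔸_{F⁺})` carried by the right translation `Φ ↦ Φ(· a)` (some `a ∈ U(V)(𝔸_{F⁺})` commuting with the finite-adelic factor) INTO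
`cohForms (archFactorOf F V)`; `σ` a representation of `U(V)(𝔸_{F⁺,f})` with an INJECTIVE `rightRep`-equivariant linear `ψ : σ → A`.  Then for
every open compact `K` the `K`-fixed vectors `σ^K` are finite-dimensional: `w ↦ (ψ w)(· a)` embeds `σ^K` into the right-`K`-invariant members of
`cohForms (archFactorOf F V)` (★ `finite_cohForms_inf_invariants`). [cite: BorelWallach2000, VII 3.2 and XIII 1.2] [cite: BernsteinZelevinsky1976, §2.1] -/
theorem finite_fixedPoints_of_frameTransport (F : HodgeCM.CMField) {ι₁ : F →+* ℂ} (V : HodgeCM.HermSpace3 F ι₁)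
    (h4 : 4 ≤ Module.finrank ℚ F) (A : Submodule ℂ ((adelicDatum F V).Adelic → (Fin 2 → ℂ))) (a : (adelicDatum F V).Adelic)
    (hcomm : ∀ g : ↥(HodgeCM.HermSpace3.adelicFin V), finToAdelic F V g * a = a * finToAdelic F V g)
    (hmem : ∀ Φ ∈ A, (fun y => Φ (y * a)) ∈ cohForms (archFactorOf F V))
    {W : Type*} [AddCommGroup W] [Module ℂ W] (σ : Representation ℂ ↥(HodgeCM.HermSpace3.adelicFin V) W)
    (ψ : W →ₗ[ℂ] ((adelicDatum F V).Adelic → (Fin 2 → ℂ)))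
    (hE : ∀ (g : ↥(HodgeCM.HermSpace3.adelicFin V)) (w : W), ψ (σ g w) = rightRep F V g (ψ w)) (hψA : ∀ w, ψ w ∈ A)
    (hinj : Function.Injective ψ) (K : Subgroup ↥(HodgeCM.HermSpace3.adelicFin V))
    (hKo : IsOpen (K : Set ↥(HodgeCM.HermSpace3.adelicFin V))) (hKc : IsCompact (K : Set ↥(HodgeCM.HermSpace3.adelicFin V))) :
    Module.Finite ℂ ↥(σ.fixedPoints K) := by
  haveI := F0P2aCohFormsFixedFinite.finite_cohForms_inf_invariants F V h4 K hKo hKc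
  -- the value `(ψ w)(· a)` of a `K`-fixed `w` is a right-`K`-invariant cohomological cotangent form of the factor of record
  have hval : ∀ w : ↥(σ.fixedPoints K), (fun y => ψ (w : W) (y * a)) ∈
      cohForms (archFactorOf F V) ⊓ Representation.invariants ((rightRep F V).comp K.subtype) := by
    rintro ⟨w, hw⟩
    refine ⟨hmem _ (hψA w), ?_⟩
    rw [Representation.mem_fixedPoints] at hw
    change (fun y => ψ w (y * a)) ∈ Representation.invariants ((rightRep F V).comp K.subtype)
    rw [Representation.mem_invariants]
    intro k
    funext y
    change ψ w (y * finToAdelic F V (k : ↥(HodgeCM.HermSpace3.adelicFin V)) * a) = ψ w (y * a)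
    calc ψ w (y * finToAdelic F V (k : ↥(HodgeCM.HermSpace3.adelicFin V)) * a)
        = ψ w (y * a * finToAdelic F V (k : ↥(HodgeCM.HermSpace3.adelicFin V))) := by rw [mul_assoc, hcomm, ← mul_assoc]
      _ = rightRep F V (k : ↥(HodgeCM.HermSpace3.adelicFin V)) (ψ w) (y * a) := rfl
      _ = ψ (σ (k : ↥(HodgeCM.HermSpace3.adelicFin V)) w) (y * a) := by rw [hE]
      _ = ψ w (y * a) := by rw [hw _ k.2]
  let Ψ : ↥(σ.fixedPoints K) →ₗ[ℂ] ↥(cohForms (archFactorOf F V) ⊓ Representation.invariants ((rightRep F V).comp K.subtype)) :=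
    { toFun := fun w => ⟨fun y => ψ (w : W) (y * a), hval w⟩
      map_add' := fun w w' => Subtype.ext (funext fun y => by simp [map_add])
      map_smul' := fun r w => Subtype.ext (funext fun y => by simp [map_smul]) }
  refine Module.Finite.of_injective Ψ fun w w' h => ?_
  apply Subtype.ext
  apply hinj
  have h' : (fun y => ψ (w : W) (y * a)) = fun y => ψ (w' : W) (y * a) := congrArg Subtype.val h
  funext x
  have hx := congrFun h' (x * a⁻¹)
  simpa only [inv_mul_cancel_right] using hx

/-! ## §3 The registered letter S3 (`AdmissibleOfCohValuedType`, body verbatim) -/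

/-- **S3 modulo a frame transport** — the BODY of `F0P2aCohIsotypicLine.AdmissibleOfCohValuedType` from ANY transport `htrans` of the shape
of ★ `F0P2aFrameTransport.mem_cohForms_frameTransport` (an archimedean `a` commuting with `U(H)(𝔸_f)` carrying `coh_T` into `coh_{T'}`): §1 (ψ
injective) + the hermitian 3-space `V₀ = (H, T)` over `⟨L⟩` (hermitian by ★ `cmConjRingHom_apply_eq_of_formCongr_eq_J`; `cohForms (archFactorOf ⟨L⟩ V₀)`
IS the generic `CotangentForms.cohForms` at HodgeCM's Sylvester frame by `rfl`) + §2. [cite: BernsteinZelevinsky1976, §2.1]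
[cite: BorelWallach2000, VII 3.2 and XIII 1.2] -/
theorem stubS3_holds_of_transport
    (htrans : ∀ (L : Type) [Field L] [NumberField L] [IsCMField L] (ι : L →+* ℂ) (H : Matrix (Fin 3) (Fin 3) L) (T : GL (Fin 3) ℂ)
      (hT : (T : Matrix (Fin 3) (Fin 3) ℂ)ᴴ * H.map ι * (T : Matrix (Fin 3) (Fin 3) ℂ) = Literature.Geometry.ComplexHyperbolic.BallModel.J)
      (T' : GL (Fin 3) ℂ)
      (hT' : (T' : Matrix (Fin 3) (Fin 3) ℂ)ᴴ * H.map ι * (T' : Matrix (Fin 3) (Fin 3) ℂ) = Literature.Geometry.ComplexHyperbolic.BallModel.J),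
      ∃ a : (adelicGroupData (↥(maximalRealSubfield L)) L (IsCMField.complexConj L) 3 H).Adelic,
        (∀ g : finAdelic (↥(maximalRealSubfield L)) L (IsCMField.complexConj L) 3 H,
          Commute (finAdelicToAdelic (↥(maximalRealSubfield L)) L (IsCMField.complexConj L) 3 H g) a) ∧
        ∀ Φ : (adelicGroupData (↥(maximalRealSubfield L)) L (IsCMField.complexConj L) 3 H).Adelic → (Fin 2 → ℂ),
          Φ ∈ CotangentForms.cohForms (↥(maximalRealSubfield L)) L (IsCMField.complexConj L) 3 H (cmArchSection L ι H T hT)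
            (cmCompactFactor L ι H T hT) →
          (fun y => Φ (y * a)) ∈ CotangentForms.cohForms (↥(maximalRealSubfield L)) L (IsCMField.complexConj L) 3 H (cmArchSection L ι H T' hT')
            (cmCompactFactor L ι H T' hT')) :
    ∀ (L : Type) [Field L] [NumberField L] [IsCMField L] (ι : L →+* ℂ) (H : Matrix (Fin 3) (Fin 3) L) (T : GL (Fin 3) ℂ)
    (hT : (T : Matrix (Fin 3) (Fin 3) ℂ)ᴴ * H.map ι * (T : Matrix (Fin 3) (Fin 3) ℂ) = Literature.Geometry.ComplexHyperbolic.BallModel.J),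
    (∀ τ' : L →+* ℂ, InfinitePlace.mk τ' ≠ InfinitePlace.mk ι → (H.map τ').PosDef) →
    2 ≤ Module.finrank ℚ ↥(maximalRealSubfield L) →
    ∀ (W : Type) [AddCommGroup W] [Module ℂ W]
      (σ : Representation ℂ (finAdelic (↥(maximalRealSubfield L)) L (IsCMField.complexConj L) 3 H) W), σ.IsIrreducible → σ.IsSmooth →
    ∀ ψ : W →ₗ[ℂ] ((adelicGroupData (↥(maximalRealSubfield L)) L (IsCMField.complexConj L) 3 H).Adelic → (Fin 2 → ℂ)),
      (∀ (g : finAdelic (↥(maximalRealSubfield L)) L (IsCMField.complexConj L) 3 H) (w : W),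
        ψ (σ g w) = CotangentForms.rightRep (↥(maximalRealSubfield L)) L (IsCMField.complexConj L) 3 H g (ψ w)) →
      (∀ w : W, ψ w ∈ CotangentForms.cohForms (↥(maximalRealSubfield L)) L (IsCMField.complexConj L) 3 H (cmArchSection L ι H T hT)
        (cmCompactFactor L ι H T hT)) → ψ ≠ 0 →
      σ.IsAdmissible := by
  intro L _ _ _ ι H T hT hdef h2 W _ _ σ hirr hsm ψ hE hcoh hne
  -- (1) the hermitian 3-space `V₀ = (H, T)` over the bundled CM field `⟨L⟩`: replace `H` by `V₀.Hm` throughout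
  obtain ⟨V₀, hV₀⟩ : ∃ V₀ : HodgeCM.HermSpace3 (⟨L⟩ : HodgeCM.CMField) ι, HodgeCM.HermSpace3.Hm V₀ = H :=
    ⟨⟨H, fun i j => cmConjRingHom_apply_eq_of_formCongr_eq_J L H ι T (formCongr_eq_of_conjTranspose L ι H T hT) i j,
      ⟨T, by rw [Literature.AlgebraicGeometry.ShimuraVarieties.UnitaryBallUniformisationDatum.signatureMatrix_two]; exact hT⟩, hdef⟩, rfl⟩
  subst hV₀
  refine ⟨hsm, fun K hK => ?_⟩
  -- (2) Schur: `ψ` is injective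
  have hinj : Function.Injective ψ :=
    injective_of_equivariant_ne_zero σ (CotangentForms.rightRep (↥(maximalRealSubfield L)) L (IsCMField.complexConj L) 3
      (HodgeCM.HermSpace3.Hm V₀)) hirr ψ hE hne
  -- `4 ≤ [L:ℚ]`
  have h4 : 4 ≤ Module.finrank ℚ (⟨L⟩ : HodgeCM.CMField) := by
    have h := Module.finrank_mul_finrank ℚ ↥(maximalRealSubfield L) L
    rw [Algebra.IsQuadraticExtension.finrank_eq_two ↥(maximalRealSubfield L) L] at h
    change 4 ≤ Module.finrank ℚ L
    omega
  -- (3) the frame transport to HodgeCM's Sylvester frame of `V₀`, i.e. to the factor of record `archFactorOf ⟨L⟩ V₀` (whose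
  -- `cohForms` ARE the generic ones at `(cmArchSection … V₀.sylvesterFrame …, cmCompactFactor …)` by `rfl`)
  obtain ⟨a, hcomm, hmem⟩ := htrans L ι (HodgeCM.HermSpace3.Hm V₀) T hT V₀.sylvesterFrame (HodgeCM.Model.sylvesterFrame_J V₀)
  -- (4) the core
  exact finite_fixedPoints_of_frameTransport ⟨L⟩ V₀ h4 _ a (fun g => (hcomm g).eq) hmem σ ψ hE hcoh hinj (K : Subgroup _)
    K.isOpen hK

/-- **S3 · admissibility for free — `stubS3_holds`**, the BODY of the registered `F0P2aCohIsotypicLine.AdmissibleOfCohValuedType` (line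
fe64be0a9875628f :196–:204) TOKEN FOR TOKEN with the line's abbreviations `𝒰`, `Gf`, `Rf`, `coh` unfolded: an irreducible SMOOTH `σ` of
`U(H)(𝔸_{L⁺,f})` admitting a NON-ZERO `rightRep`-equivariant linear map into the `(1,0) ⊕ (0,1)` cohomological cotangent forms of the CM factor
`(cmArchSection L ι H T hT, cmCompactFactor L ι H T hT)` of ANY frame is ADMISSIBLE.  = `stubS3_holds_of_transport` at the frame transport ★
`F0P2aFrameTransport.mem_cohForms_frameTransport` (F0P2a-p06, p795940).  Fold for the next edition of the line:
`theorem stub_admissible_of_cohValued : AdmissibleOfCohValuedType := F0P2aStubAdmissibleOfCohValued.stubS3_holds`.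
[cite: BernsteinZelevinsky1976, §2.1] [cite: BorelWallach2000, VII 3.2 and XIII 1.2] -/
theorem stubS3_holds :
    ∀ (L : Type) [Field L] [NumberField L] [IsCMField L] (ι : L →+* ℂ) (H : Matrix (Fin 3) (Fin 3) L) (T : GL (Fin 3) ℂ)
    (hT : (T : Matrix (Fin 3) (Fin 3) ℂ)ᴴ * H.map ι * (T : Matrix (Fin 3) (Fin 3) ℂ) = Literature.Geometry.ComplexHyperbolic.BallModel.J),
    (∀ τ' : L →+* ℂ, InfinitePlace.mk τ' ≠ InfinitePlace.mk ι → (H.map τ').PosDef) →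
    2 ≤ Module.finrank ℚ ↥(maximalRealSubfield L) →
    ∀ (W : Type) [AddCommGroup W] [Module ℂ W]
      (σ : Representation ℂ (finAdelic (↥(maximalRealSubfield L)) L (IsCMField.complexConj L) 3 H) W), σ.IsIrreducible → σ.IsSmooth →
    ∀ ψ : W →ₗ[ℂ] ((adelicGroupData (↥(maximalRealSubfield L)) L (IsCMField.complexConj L) 3 H).Adelic → (Fin 2 → ℂ)),
      (∀ (g : finAdelic (↥(maximalRealSubfield L)) L (IsCMField.complexConj L) 3 H) (w : W),
        ψ (σ g w) = CotangentForms.rightRep (↥(maximalRealSubfield L)) L (IsCMField.complexConj L) 3 H g (ψ w)) →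
      (∀ w : W, ψ w ∈ CotangentForms.cohForms (↥(maximalRealSubfield L)) L (IsCMField.complexConj L) 3 H (cmArchSection L ι H T hT)
        (cmCompactFactor L ι H T hT)) → ψ ≠ 0 →
      σ.IsAdmissible :=
  stubS3_holds_of_transport fun L _ _ _ ι H T hT T' hT' => F0P2aFrameTransport.mem_cohForms_frameTransport L ι H T T' hT hT'

end Summit.HodgeConjecture.HodgeConjecture.Cruxes.H413.F0P2aStubAdmissibleOfCohValued

end
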